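import Summits.PneNP.PneNP.Theorems.SoloInformedIOShape
import Literature.Computability.Cryptography.LevinUniversalWorstCase
import Literature.Computability.MetaComplexity.ClockedUniversalRun
import HarnessLib

/-!
# Solo (informed) — the summit is the worst-case one-wayness of ONE explicit function

`PneNP` is stated as `∃ L ∈ NP, L ∉ P`, an `∃∀` over machines. This file records, as
kernel-checked equivalences, the `∃`-free *cryptographic* reading: for every efficient universal
machine `U` (hypothesis structure `UniversalMachine`; the tree's fixed instance is `stdU`), Levin's
explicitly written polynomial-time function `levinUniv U d`
(`f_uni(desc(M), x) = (desc(M), M(x))`, step budget `|z|^d`; Goldreich, *Foundations of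
Cryptography I*, §2.4.1, eq. (2.9)) decides the summit:

* `soloInformed_pneNP_iff_exists_levinUniv_oneWay` — `PneNP` iff for some budget exponent `d`
  every polynomial-time `G` fails to invert `levinUniv U d` on some `⟨1^{|z|}, f_uni(z)⟩`;
* `soloInformed_pneNP_iff_eventually_levinUniv_oneWay` — the same with `∃ d₀ ∀ d ≥ d₀`;
* `soloInformed_pneNP_iff_levinUniv_stdU_oneWay` — the instance at the tree's fixed universal
  machine `stdU`: **`P ≠ NP` iff one specific, explicitly written `FP` function (family indexed by
  `d ∈ ℕ`) has no polynomial-time worst-case inverter.**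

So the summit "reduces", exactly as Goldreich remarks for average-case one-way functions
(§2.4.1, discussion after Prop. 2.4.1), to the invertibility of a single specific function; the
average-case (cryptographic) one-wayness of the same function is the existence of one-way
functions (`OWFExist_iff_exists_isWeaklyOneWay_levinUniv_holds`), a stronger-looking statement NOT
claimed equivalent to the summit here. Two-line consequences of
`Literature.Computability.Cryptography.not_NP_subset_P_iff_exists_levinUniv_oneWay` and the solo
I/O-shape lemma `soloInformed_pneNP_iff_exists_not_mem`.
-/

namespace Summit.PneNP.PneNP.Theorems

open Literature.Computability.Complexity Literature.Computability.Cryptography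
  Literature.Computability.MetaComplexity _root_.Computability

/-- **`P ≠ NP` iff Levin's universal function is worst-case one-way for some budget exponent**
(for every efficient universal machine `U`).
[cite: Goldreich2001FoC1, §2.4.1 Prop. 2.4.1 (worst-case reading; held book:goldreich2004-foundations-cryptography chunks p0073-p0074)]
[cite: RotheJ2005, Prop. 8.35 (held book:rothend-complexity-theory-cryptology chunk p0489)] -/
theorem soloInformed_pneNP_iff_exists_levinUniv_oneWay (U : UniversalMachine) :
    PneNP ↔ ∃ d : ℕ, ∀ G ∈ FP, ∃ (m : ℕ) (z : List Bool), z.length = m ∧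
      levinUniv U d (G (boolPair (unaryEncodeNat m) (levinUniv U d z))) ≠ levinUniv U d z := by
  rw [soloInformed_pneNP_iff_exists_not_mem, ← not_NP_subset_P_iff_exists_levinUniv_oneWay U,
    Set.not_subset]

/-- **Eventual form**: `P ≠ NP` iff `levinUniv U d` is worst-case one-way for all large `d`.
[cite: Goldreich2001FoC1, §2.4.1 Prop. 2.4.1 (held book:goldreich2004-foundations-cryptography chunk p0073)] -/
theorem soloInformed_pneNP_iff_eventually_levinUniv_oneWay (U : UniversalMachine) :
    PneNP ↔ ∃ d₀ : ℕ, ∀ d, d₀ ≤ d → ∀ G ∈ FP, ∃ (m : ℕ) (z : List Bool), z.length = m ∧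
      levinUniv U d (G (boolPair (unaryEncodeNat m) (levinUniv U d z))) ≠ levinUniv U d z := by
  rw [soloInformed_pneNP_iff_exists_not_mem, ← not_NP_subset_P_iff_eventually_levinUniv_oneWay U,
    Set.not_subset]

/-- **The summit as a property of one explicit function**: at the tree's fixed efficient universal
machine `stdU`, `P ≠ NP` iff some member of the explicit family `levinUniv stdU d` has no
polynomial-time worst-case inverter.
[cite: Goldreich2001FoC1, §2.4.1 Prop. 2.4.1 and discussion (held book:goldreich2004-foundations-cryptography chunks p0073-p0074)]
[cite: Levin1987, (universal one-way function; not held)] -/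
theorem soloInformed_pneNP_iff_levinUniv_stdU_oneWay :
    PneNP ↔ ∃ d : ℕ, ∀ G ∈ FP, ∃ (m : ℕ) (z : List Bool), z.length = m ∧
      levinUniv stdU d (G (boolPair (unaryEncodeNat m) (levinUniv stdU d z))) ≠
        levinUniv stdU d z :=
  soloInformed_pneNP_iff_exists_levinUniv_oneWay stdU

end Summit.PneNP.PneNP.Theorems
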